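import Summits.MatrixMultiplication.MatrixMultiplication.Theorems.ShapeSubmodularityPerfectAmortisationStubCwRectRestriction
import Literature.Computability.AlgebraicComplexity.LaserMethodTypeCount
import Literature.Computability.AlgebraicComplexity.LaserMethodBigCW
import Literature.Computability.AlgebraicComplexity.MaxEntropyGivenMarginals
import Literature.Computability.AlgebraicComplexity.AsymptoticRankMultiplesMatMul
import Literature.Computability.AlgebraicComplexity.CoppersmithWinograd1990Proofs
import Literature.Computability.AlgebraicComplexity.BigCoppersmithWinogradProofs
import Literature.Computability.AlgebraicComplexity.RectangularExponentBounds
import Literature.Computability.AlgebraicComplexity.RectangularExponentSubadditivity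
import Literature.Computability.AlgebraicComplexity.RectangularExponentSymmetry
import Literature.Computability.AlgebraicComplexity.RectangularExponentHomogeneity
import Literature.Barriers.MatrixMultiplication.UniversalMethodBarrierAsymptoticRank
import Mathlib.Analysis.SpecialFunctions.BinaryEntropy
import HarnessLib

/-!
# `ExpSaturation` (route `SaturationLadder`, stmt-MatrixMultiplication-25913) — file 1/3: layers B1 and B2

Layer B1 `famDiagonalRaw`: a large free diagonal of the joint type `(m(k+1), mk, mc, mk)`, `N = (q+2)km`, of the
first-power `CW_q` laser method (tree `exists_free_diagonal_jointType_card`); layer B2: entropy evaluation of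
the law `(p − θ, θ, 1 − θ − p, θ)` on the CW support (marginals, `Γ_S(P) = 0`, the `X`-marginal entropy,
`entropyX_eq`).

Landing note: the lens-1 kernel `ExpSaturation.lean` (decomp-mm gen 4; sha256 de524bf9…328c, 913 lines,
rc 0 · 0 sorry · std axioms, critic-endorsed 2026-08-30T04:10:26Z) is landed as three files for the gate rule
«Theorems files with proofs ≤ 400 lines» — `SaturationLadderExpSaturationDiagonal` (layers B1, B2),
`SaturationLadderExpSaturationEntropy` (the entropy inequality in closed form, `famEntropy`, `famDiagonal`,
layer C `famThreshold`) and `SaturationLadderExpSaturation` (assembly `ω(k+1,k,c) ≤ qk`, the entropy condition at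
`q = 4^(k+2)`, the closers `expSaturation_holds` / `eventualTightness_holds`, and `subexpSaturation_above_log_four`);
statements and proofs are unchanged (one namespace `…Theorems.SaturationLadderExpSaturation` throughout), except
that the two folklore identities `H(1−p,p,0) = H(p,1−p,0) = h(p)/log 2` — verbatim the tree's
`PerfectAmortisation.shannonEntropy_vec3_eq_binEntropy'` / `…_eq_binEntropy`, whose module
`Theorems/ShapeSubmodularityPerfectAmortisationStubCwRectEntropy.lean` has no farm olean at landing time
(rc 75 `remote:stale:unbuilt`) — are proved locally inside `famEntropy` instead of being restated
(gate rule `dedup.landed`); the helper files import no route (`Theses`) file (gate lint `theses-cone`).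
The overview (certificate, references) is the module docstring of `Theorems/SaturationLadderExpSaturation.lean`.
-/

set_option linter.dupNamespace false
-- (single-conjunct summit: the namespace repeats `MatrixMultiplication`)

noncomputable section

open Finset
open scoped BigOperators

namespace Summit.MatrixMultiplication.MatrixMultiplication.Theorems.SaturationLadderExpSaturation

open Literature.Computability.AlgebraicComplexity
open Literature.Barriers.MatrixMultiplication
open Summit.MatrixMultiplication.MatrixMultiplication.Theorems.PerfectAmortisation
  (stub_cwRectRestriction)

/-! ## Layer B1 — a large free diagonal of the joint type `(m(k+1), mk, mc, mk)`, `N = (q+2)km` -/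

/-- **Combinatorial layer (parametric).** For `k, m ≥ 1`, `q k = k + 1 + c`, `N = (q+2) k m` and
`P = Q/N` with `Q(1,1,0) = m(k+1)`, `Q(0,1,1) = mk`, `Q(1,0,1) = mc`, `Q(2,0,0) = mk` (`0` elsewhere),
there is a family `Δ` of triples of level words, coordinatewise in `cwSupport₃ = {i+j+l = 2}`, each
with exactly `m(k+1)`, `mk`, `mc` positions of pattern `(1,1,0)`, `(0,1,1)`, `(1,0,1)`, forming a
free diagonal, with `2^{N (min_m H(P_m) − Γ_S(P))} ≤ |Δ| · (N+1)^63 · 192 · exp(4 √(log 6 + N log 27))`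
(`exists_free_diagonal_jointType_card` for `S = cwSupport₃`, `b = 2`, `G = 27`, `A = 9`).
[cite: LeGall2014, Appendix A.3, Eq. (7) and p. 24] -/
theorem famDiagonalRaw :
    ∀ q k c m : ℕ, 1 ≤ k → 1 ≤ m → q * k = k + 1 + c → ∀ P : Fin 3 × Fin 3 × Fin 3 → ℝ,
      (∀ s, P s = ((if s = (1, 1, 0) then m * (k + 1) else if s = (0, 1, 1) then m * k
          else if s = (1, 0, 1) then m * c else if s = (2, 0, 0) then m * k else 0 : ℕ) : ℝ) /
            ((((q + 2) * k * m : ℕ)) : ℝ)) →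
      ∃ Δ : Finset ((Fin ((q + 2) * k * m) → Fin 3) × (Fin ((q + 2) * k * m) → Fin 3) ×
          (Fin ((q + 2) * k * m) → Fin 3)),
        (∀ δ ∈ Δ, ∀ ρ, labelSeq δ ρ ∈ cwSupport₃) ∧
        (∀ δ ∈ Δ, letterCount (labelSeq δ) (1, 1, 0) = m * (k + 1) ∧
          letterCount (labelSeq δ) (0, 1, 1) = m * k ∧ letterCount (labelSeq δ) (1, 0, 1) = m * c) ∧
        (∀ δ ∈ Δ, ∀ δ' ∈ Δ, ∀ δ'' ∈ Δ, (∀ ρ, (δ.1 ρ, δ'.2.1 ρ, δ''.2.2 ρ) ∈ cwSupport₃) →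
          δ = δ' ∧ δ' = δ'') ∧
        (2 : ℝ) ^ (((((q + 2) * k * m : ℕ)) : ℝ) *
            (min (shannonEntropy (marginalDist₁ P))
              (min (shannonEntropy (marginalDist₂ P)) (shannonEntropy (marginalDist₃ P))) -
              maxEntropyPenalty cwSupport₃ P)) ≤
          (Δ.card : ℝ) * ((((((q + 2) * k * m : ℕ)) : ℝ)) + 1) ^ 63 * 192 *
            Real.exp (4 * Real.sqrt (Real.log 6 + ((((q + 2) * k * m : ℕ)) : ℝ) * Real.log 27)) := by
  intro q k c m hk hm hqk P hP
  classical
  -- tightness data of `cwSupport₃` (as in `bigCw_laser_inequality`)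
  have hinj : Function.Injective fun (i : Fin 3) (_ : Fin 1) => (i : ℤ) := by
    intro i i' h
    have h0 := congrFun h 0
    simp only [Nat.cast_inj] at h0
    exact Fin.ext h0
  have hinjγ : Function.Injective fun (l : Fin 3) (_ : Fin 1) => (l : ℤ) - 2 := by
    intro l l' h
    have h0 := congrFun h 0
    simp only [sub_left_inj, Nat.cast_inj] at h0
    exact Fin.ext h0
  have hbd : ∀ (i : Fin 3) (ρ : Fin 1), |((fun (i : Fin 3) (_ : Fin 1) => (i : ℤ)) i ρ)| ≤ (2 : ℕ) := by
    intro i ρ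
    have := i.isLt
    simp only [Nat.cast_ofNat, Nat.abs_cast]
    omega
  have htight : ∀ s ∈ cwSupport₃, ∀ ρ : Fin 1,
      (fun (i : Fin 3) (_ : Fin 1) => (i : ℤ)) s.1 ρ + (fun (j : Fin 3) (_ : Fin 1) => (j : ℤ)) s.2.1 ρ +
        (fun (l : Fin 3) (_ : Fin 1) => (l : ℤ) - 2) s.2.2 ρ = 0 := by
    intro s hs ρ
    rw [mem_cwSupport₃] at hs
    simp only
    omega
  -- the joint type `Q` and `N = (q+2) k m`
  obtain ⟨Q, hQdef⟩ : ∃ Q : Fin 3 × Fin 3 × Fin 3 → ℕ, Q = fun s =>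
      if s = (1, 1, 0) then m * (k + 1) else if s = (0, 1, 1) then m * k
      else if s = (1, 0, 1) then m * c else if s = (2, 0, 0) then m * k else 0 :=
    ⟨_, rfl⟩
  have hN : 0 < (q + 2) * k * m := Nat.mul_pos (Nat.mul_pos (by omega) (by omega)) (by omega)
  have hQS : ∀ s, s ∉ cwSupport₃ → Q s = 0 := by
    intro s hs
    rw [mem_cwSupport₃_iff] at hs
    push Not at hs
    obtain ⟨h1, h2, h3, h4, -, -⟩ := hs
    simp [hQdef, h1, h2, h3, h4]
  have hsumQ : m * (k + 1) + m * k + m * c + m * k = (q + 2) * k * m := by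
    have h1 : (q + 2) * k * m = (q * k) * m + 2 * k * m := by ring
    rw [h1, hqk]
    ring
  have hQ : ∑ s, Q s = (q + 2) * k * m := by
    rw [sum_triple_eq, hQdef, ← hsumQ]
    simp [Fin.sum_univ_three]
    ring
  have hP' : ∀ s, P s = (Q s : ℝ) / ((((q + 2) * k * m : ℕ)) : ℝ) := by
    intro s
    rw [hQdef]
    exact hP s
  -- the tree theorem
  obtain ⟨Δ, hΔQ, hfree, hsize⟩ := exists_free_diagonal_jointType_card cwSupport₃ (r := 1) (b := 2)
    (fun (i : Fin 3) (_ : Fin 1) => (i : ℤ)) (fun (j : Fin 3) (_ : Fin 1) => (j : ℤ))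
    (fun (l : Fin 3) (_ : Fin 1) => (l : ℤ) - 2) hinj hinj hinjγ hbd hbd htight hN Q hQS hQ P hP'
  have hQδ : ∀ δ ∈ Δ, letterCount (labelSeq δ) = Q := fun δ hδ => (Finset.mem_filter.1 (hΔQ hδ)).2
  refine ⟨Δ, ?_, ?_, hfree, ?_⟩
  · -- coordinatewise support
    intro δ hδ ρ
    by_contra hρ
    have h0 := hQS _ hρ
    rw [← hQδ δ hδ] at h0
    exact (letterCount_pos_of_apply (labelSeq δ) ρ).ne' h0
  · -- the three letter counts
    intro δ hδ
    rw [hQδ δ hδ, hQdef]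
    simp
  · -- the size bound, constants evaluated
    refine hsize.trans_eq ?_
    have hmax : (max 2 1 : ℕ) = 2 := by decide
    generalize ((((q + 2) * k * m : ℕ)) : ℝ) = Nr
    simp only [Fintype.card_prod, Fintype.card_fin, hmax]
    norm_num
    simp only [mul_assoc]

/-! ## Layer B2 — entropy evaluation of the law `(p − θ, θ, 1 − θ − p, θ)` on the CW support -/

/-- The three marginals of the law `p − θ` on `(1,1,0)`, `θ` on `(0,1,1)`, `1 − θ − p` on `(1,0,1)`,
`θ` on `(2,0,0)`: `(θ, 1 − 2θ, θ)`, `(1 − p, p, 0)`, `(p, 1 − p, 0)`. [folklore] -/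
theorem marginalDist_fam {P : Fin 3 × Fin 3 × Fin 3 → ℝ} {θ p : ℝ}
    (hP : ∀ s, P s = if s = (1, 1, 0) then p - θ else if s = (0, 1, 1) then θ
      else if s = (1, 0, 1) then 1 - θ - p else if s = (2, 0, 0) then θ else 0) :
    marginalDist₁ P = ![θ, 1 - 2 * θ, θ] ∧ marginalDist₂ P = ![1 - p, p, 0] ∧
      marginalDist₃ P = ![p, 1 - p, 0] := by
  refine ⟨?_, ?_, ?_⟩ <;> funext i <;> fin_cases i <;>
    simp [marginalDist₁, marginalDist₂, marginalDist₃, Fin.sum_univ_three, hP] <;> ring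

/-- The law vanishes off the support `{i + j + l = 2}` of `CW_q`. [folklore] -/
theorem fam_eq_zero_of_not_mem {P : Fin 3 × Fin 3 × Fin 3 → ℝ} {θ p : ℝ}
    (hP : ∀ s, P s = if s = (1, 1, 0) then p - θ else if s = (0, 1, 1) then θ
      else if s = (1, 0, 1) then 1 - θ - p else if s = (2, 0, 0) then θ else 0)
    {s : Fin 3 × Fin 3 × Fin 3} (hs : s ∉ cwSupport₃) : P s = 0 := by
  rw [mem_cwSupport₃_iff] at hs
  push Not at hs
  rw [hP]
  simp [hs.1, hs.2.1, hs.2.2.1, hs.2.2.2.1]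

/-- **`D(P) = {P}`**: a distribution supported in `{i + j + l = 2}` with the marginals of the law
above coincides with it — the level-`2` marginals in `Y` and `Z` vanish, killing `(0,2,0)` and
`(0,0,2)`, the `X`-marginal at level `2` fixes `(2,0,0)`, and then each matrix pattern is read off
from one level-`0` marginal. [folklore] -/
theorem eq_of_mem_sameMarginalsOn_fam {P P' : Fin 3 × Fin 3 × Fin 3 → ℝ} {θ p : ℝ}
    (hP : ∀ s, P s = if s = (1, 1, 0) then p - θ else if s = (0, 1, 1) then θ
      else if s = (1, 0, 1) then 1 - θ - p else if s = (2, 0, 0) then θ else 0)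
    (hP' : P' ∈ sameMarginalsOn cwSupport₃ P) : P' = P := by
  obtain ⟨-, hoff, h₁, h₂, h₃⟩ := hP'
  obtain ⟨hm₁, hm₂, hm₃⟩ := marginalDist_fam hP
  -- the off-support zeros of `P'`
  have z : ∀ a b c : Fin 3, (a : ℕ) + b + c ≠ 2 → P' (a, b, c) = 0 := fun a b c h =>
    hoff _ (mt mem_cwSupport₃.1 h)
  -- the six marginal equations we use
  have e₁ : marginalDist₁ P' 2 = θ := by rw [h₁, hm₁]; simp
  have e₂ : marginalDist₂ P' 2 = 0 := by rw [h₂, hm₂]; simp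
  have e₃ : marginalDist₃ P' 2 = 0 := by rw [h₃, hm₃]; simp
  have f₁ : marginalDist₁ P' 0 = θ := by rw [h₁, hm₁]; simp
  have f₂ : marginalDist₂ P' 0 = 1 - p := by rw [h₂, hm₂]; simp
  have f₃ : marginalDist₃ P' 0 = p := by rw [h₃, hm₃]; simp
  simp (disch := decide) only [marginalDist₁, marginalDist₂, marginalDist₃, Fin.sum_univ_three, z,
    add_zero, zero_add] at e₁ e₂ e₃ f₁ f₂ f₃
  have p011 : P' (0, 1, 1) = θ := by linarith
  have p101 : P' (1, 0, 1) = 1 - θ - p := by linarith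
  have p110 : P' (1, 1, 0) = p - θ := by linarith
  funext s
  by_cases hs : s ∈ cwSupport₃
  · rw [hP]
    rw [mem_cwSupport₃_iff] at hs
    rcases hs with rfl | rfl | rfl | rfl | rfl | rfl <;> simp [p011, p101, p110, e₁, e₂, e₃]
  · rw [hoff s hs, fam_eq_zero_of_not_mem hP hs]

/-- **The penalty vanishes**: `Γ_S(P) = max_{D(P)} H − H(P) ≤ 0` for the law above, provided it IS
a probability distribution (`0 ≤ θ ≤ p`, `θ + p ≤ 1`). [folklore] -/
theorem maxEntropyPenalty_fam_nonpos {P : Fin 3 × Fin 3 × Fin 3 → ℝ} {θ p : ℝ}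
    (hP : ∀ s, P s = if s = (1, 1, 0) then p - θ else if s = (0, 1, 1) then θ
      else if s = (1, 0, 1) then 1 - θ - p else if s = (2, 0, 0) then θ else 0)
    (h0 : 0 ≤ θ) (h1 : θ ≤ p) (h2 : θ + p ≤ 1) :
    maxEntropyPenalty cwSupport₃ P ≤ 0 := by
  have hsimplex : P ∈ stdSimplex ℝ (Fin 3 × Fin 3 × Fin 3) := by
    refine ⟨fun s => ?_, ?_⟩
    · rw [hP]
      split_ifs <;> linarith
    · rw [sum_triple_eq]
      simp [Fin.sum_univ_three, hP]
  have hsupp : ∀ x, x ∉ cwSupport₃ → P x = 0 := fun x hx => fam_eq_zero_of_not_mem hP hx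
  have hle : maxEntropyGivenMarginals cwSupport₃ P ≤ shannonEntropy P :=
    maxEntropyGivenMarginals_le ⟨P, self_mem_sameMarginalsOn hsimplex hsupp⟩
      fun P' hP' => (congrArg shannonEntropy (eq_of_mem_sameMarginalsOn_fam hP hP')).le
  exact sub_nonpos.2 hle

/-- `H(θ, 1 − 2θ, θ) = (2 η(θ) + η(1 − 2θ)) / log 2` (bits; `η = negMulLog`). [folklore] -/
theorem shannonEntropy_vec3_X (θ : ℝ) :
    shannonEntropy ![θ, 1 - 2 * θ, θ] =
      (2 * Real.negMulLog θ + Real.negMulLog (1 - 2 * θ)) / Real.log 2 := by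
  rw [shannonEntropy_def, Fin.sum_univ_three]
  congr 1
  simp only [Matrix.cons_val_zero, Matrix.cons_val_one, Matrix.cons_val_two, Matrix.head_cons,
    Matrix.tail_cons]
  ring

/-- The `X`-entropy in closed form at `θ = 1/(q+2)`:
`2 η(1/(q+2)) + η(q/(q+2)) = log (q+2) − (q/(q+2)) log q` (nats). [folklore] -/
theorem entropyX_eq (q : ℝ) (hq : 0 < q) :
    2 * Real.negMulLog (1 / (q + 2)) + Real.negMulLog (1 - 2 * (1 / (q + 2))) =
      Real.log (q + 2) - q / (q + 2) * Real.log q := by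
  have h2 : (0 : ℝ) < q + 2 := by linarith
  have e1 : Real.negMulLog (1 / (q + 2)) = 1 / (q + 2) * Real.log (q + 2) := by
    rw [Real.negMulLog, one_div, Real.log_inv]; ring
  have e2 : 1 - 2 * (1 / (q + 2)) = q / (q + 2) := by field_simp; ring
  have e3 : Real.negMulLog (q / (q + 2)) =
      q / (q + 2) * Real.log (q + 2) - q / (q + 2) * Real.log q := by
    rw [Real.negMulLog, Real.log_div hq.ne' h2.ne']; ring
  rw [e1, e2, e3]
  field_simp
  ring

end Summit.MatrixMultiplication.MatrixMultiplication.Theorems.SaturationLadderExpSaturation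

end
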